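import Literature.AlgebraicGeometry.AbelianVarieties.MarkmanKernelDescent
import HarnessLib

/-!
# The descent twist `D′_s` under the translation `1_A × t_α` of `A × Â`:
# `(1 × t_α)^*[D′_s] = [D′_s] · [N_α]` with `N_α = pr_A^*P_α^{⊗j} ⊗ pr_Â^*P̂_{φ_Θ⁻¹(α)}^{⊗(2s+1)}`, and `(1 × t_α)^*D′_s ≅ D′_s ⊗ N_α`

Layer `Literature/AlgebraicGeometry/AbelianVarieties`; sequel to `MarkmanKernelDescent` (§2: the descent twist
`D′_s := pr_A^*Θ_sym^{⊗s} ⊗ 𝒫^{⊗j} ⊗ pr_Â^*(Θ̂^{⊗s} ⊗ [−1]^*Θ̂^{⊗(s+1)})` on `A × Â`, `descentTwist`, with its class along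
`T`-valued points `ofMul_pullback_detClass_descentTwist`) and to `MarkmanKernelTranslate` (§2–§4: the class calculus `λ`, `Λ`
along `T`-valued points, the Pic⁰ bundles `P_α = linePt`, `P̂_x = linePtHat`, and the pattern «identity in `Ȟ¹`, then module form
by `nonempty_iso_iff_detClass_eq`»). For a principally polarised complex abelian variety `(A, Θ)` (`Â = A.dualOf Θ hΘ`,
`φ_Θ⁻¹ = phiThetaInv A hΘ hK`) and a complex point `α` of `Â`, acting on `A × Â` by `1_A × t_α`
(`sndTranslationIso Â α A` of `RelativeFourierExchange`, `= t_{(1,α)}`, `MarkmanPhiExchange.sndTranslationIso_hom_eq`):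

* §1 the DISCREPANCY BUNDLE **`N_α := pr_A^*P_α^{⊗j} ⊗ pr_Â^*P̂_{φ_Θ⁻¹ α}^{⊗(2s+1)}`** (`descentTwistTranslate`; a Pic⁰-type line
  bundle on `A × Â`, pattern `translateTwist`) and its class along a `T`-valued point `h = (h₁, h₂)`:
  `j • Λ(h₁, (φ⁻¹α)_T) + (2s+1) • Λ((φ⁻¹α)_T, h₂φ⁻¹)` (`ofMul_pullback_detClass_descentTwistTranslate`);
* §2 the CLASS IDENTITY along `T`-valued points **`[D′_s](h ≫ (1 × t_α)) = [D′_s](h) + [N_α](h)`**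
  (`ofMul_pullback_whiskerLeft_translation_detClass_descentTwist`): substitute `h ↦ h ≫ (1 × t_α)` in
  `ofMul_pullback_detClass_descentTwist` — `h₁` is unchanged and `h₂φ⁻¹` becomes `(φ⁻¹α)_T · h₂φ⁻¹`
  (`translation_comp_phiThetaInv`, `comp_translation_eq_mul`) — and expand by the biadditivity of Mumford's `Λ` (the cubical
  structure, `Lam_mul_right` under `A.cubicalStructure_linEquiv_holds`) and `λ(xy) = Λ(x,y) + λ(x) + λ(y)`, `λ(c_T) = 0`:
  the `𝒫^{⊗j}` factor moves by `j • Λ(h₁, (φ⁻¹α)_T) = [pr_A^*P_α^{⊗j}](h)` and the `Â`-factor `Θ̂^{⊗s} ⊗ [−1]^*Θ̂^{⊗(s+1)}` by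
  `(s + (s+1)) • Λ((φ⁻¹α)_T, h₂φ⁻¹) = [pr_Â^*P̂_{φ⁻¹α}^{⊗(2s+1)}](h)` (Néron–Severi type `2s+1` of the `Â`-part: the theorem of the
  square, in class currency);
* §3 the identity in `Ȟ¹(A × Â, 𝒪^×)` **`(1 × t_α)^*[D′_s] = [D′_s] · [N_α]`** (`pullback_sndTranslation_detClass_descentTwist`, the
  case `T = A × Â`, `h = 𝟙`) and its MODULE FORM **`(1 × t_α)^*D′_s ≅ D′_s ⊗ N_α`** (`nonempty_pullback_sndTranslation_descentTwist_iso`,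
  rank-one modules are classified by their class; a CHOSEN representative `pullbackSndTranslationDescentTwistIso`, no normalisation
  asserted).

`D′_s` is NOT `(1 × t_α)`-invariant (`𝒫^{⊗j}` and the `Â`-part move by Pic⁰ classes); this is the row by which a translation of the
second factor is carried through the cell's functor `Φ_T = Φ ⋙ (⊗ D′_s)⁺` (`MarkmanPhiDescentTwistPullbackModel`), after the
`Φ`-rows `markmanPhi_twist_iso` / `markmanPhi_exchange_iso` of `MarkmanPhiExchange`. Everything PROVED; 0 named facts; no instance,
no notation. Typed for the cell `pub-hodge-ring2` (crux 26512, socket v2's `e₁` input); a research route conditional on HC_CM, not a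
corollary — nothing in this file refers to it.

## References

* E. Markman, *Cycles on abelian 2n-folds of Weil type from secant sheaves on abelian n-folds*, arXiv:2502.03415 (2025), §9.3
  Lemma 9.3.3 and Lemma 9.3.5, p. 71 L44–70. [Markman2025SecantWeil]
* H. Lange, *Abelian Varieties over the Complex Numbers* (2023), §6.1.1 Lemma 6.1.3 (`t_{(x,x̂)}^*𝒫 ≅ 𝒫 ⊗ p₁^*P_x̂ ⊗ p₂^*P_x`),
  §2.3 (principal polarisations). [Lange2023AbelianVarietiesComplex]
* D. Mumford, *Abelian Varieties* (1970), §6 Cor. 3–4 (theorem of the square, `Λ`), §8 (`Pic⁰`, `φ_L`). [MumfordAV1970]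
* R. Hartshorne, *Algebraic Geometry* (1977), II Ex. 6.8 (functoriality of `f^*` on `Pic`), III Ex. 4.5 (`Pic X ≅ Ȟ¹(X, 𝒪_X^×)`).
  [Hartshorne1977]
-/

noncomputable section

-- `TopCat.Presheaf`/`Scheme.Modules` are not reducible (as in Mathlib's `AlgebraicGeometry/Modules/Sheaf.lean`).
set_option backward.isDefEq.respectTransparency false

open CategoryTheory CategoryTheory.Limits AlgebraicGeometry MonoidalCategory CartesianMonoidalCategory
open AlgebraicGeometry.Scheme.Modules

namespace Literature.AlgebraicGeometry.AbelianVarieties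

open Literature.AlgebraicGeometry.Motives Literature.AlgebraicGeometry.Modules
open scoped MonObj

variable (A : AbelianVariety ℂ) {Θ : CartierDivisor A.X.left} (hΘ : Θ.IsAmple) (hK : A.KTheta Θ = ⊥)

/-! ### §0 Bookkeeping -/

section Bookkeeping

/-- `(f ≫ g)^* = f^* ∘ g^*` on `Ȟ¹(–, 𝒪^×)` (the tree's `CechPic.pullback_comp` of `Modules/UnitCocyclePresented`, outside this
file's import closure; re-proved privately as in `MarkmanKernelDescent`). [cite: Hartshorne1977, II Ex. 6.8 (functoriality of f^* on Pic)] -/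
private theorem cechPic_pullback_comp {X Y Z : Scheme.{0}} (f : X ⟶ Y) (g : Y ⟶ Z) (c : CechPic Z) :
    CechPic.pullback (f ≫ g) c = CechPic.pullback f (CechPic.pullback g c) := by
  obtain ⟨c, rfl⟩ := CechPic.mk_surjective c
  rw [CechPic.pullback_mk, CechPic.pullback_mk, CechPic.pullback_mk]
  refine CechPic.sound (UnitCocycle.equiv_of_eq _ _
    (fun x => f ⁻¹ᵁ (g ⁻¹ᵁ c.U (g.base (f.base x)))) (fun x => c.mem (g.base (f.base x)))
    (fun x => le_of_eq rfl) (fun x => le_rfl) fun x y V hx hy => ?_)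
  change (g.appLE _ _ _ ≫ f.appLE _ V _) (c.g _ _ _ _ _) = (f ≫ g).appLE _ V _ (c.g _ _ _ _ _)
  rw [Scheme.Hom.appLE_comp_appLE]
  rfl

/-- `g ≫ toSpecOver S = toSpecOver T` (maps to `Spec ℂ` over `Spec ℂ` are unique). [cite: GortzWedhorn2023, Def./Rem. 27.1 (p. 799)] -/
private theorem comp_toSpecOver {T S : SchemeOver ℂ} (g : T ⟶ S) : g ≫ toSpecOver S = toSpecOver T := by
  ext1
  rw [Over.comp_left, toSpecOver_left, toSpecOver_left, Over.w]

end Bookkeeping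

/-! ### §1 The discrepancy bundle `N_α = pr_A^*P_α^{⊗j} ⊗ pr_Â^*P̂_{φ⁻¹α}^{⊗(2s+1)}` and its class along `T`-valued points -/

section Discrepancy

variable (s j : ℕ) (α : (A.dualOf Θ hΘ).Points ℂ)

/-- **THE DISCREPANCY BUNDLE `N_α := pr_A^*P_α^{⊗j} ⊗ pr_Â^*P̂_{φ_Θ⁻¹(α)}^{⊗(2s+1)}`** on `A × Â` — the Pic⁰ line bundle by which the
descent twist `D′_s` moves under `1_A × t_α` (`P_α = 𝒫|_{A × {α}}`, `P̂_x = 𝒫|_{{x} × Â}`; the `𝒫^{⊗j}` factor of `D′_s` contributes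
`P_α^{⊗j}`, its `Â`-part `Θ̂^{⊗s} ⊗ [−1]^*Θ̂^{⊗(s+1)}` of Néron–Severi type `2s+1` contributes `P̂_{φ⁻¹α}^{⊗(2s+1)}`).
[cite: Markman2025SecantWeil, §9.3 Lemma 9.3.3 and Lemma 9.3.5 (p. 71)] [cite: Lange2023AbelianVarietiesComplex, §6.1.1 Lemma 6.1.3] -/
def descentTwistTranslate : (A.X ⊗ (A.dualOf Θ hΘ).X).left.Modules :=
  tensorObj
    ((Scheme.Modules.pullback (fst A.X (A.dualOf Θ hΘ).X).left).obj (tensorPow (linePt A hΘ hK α) j))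
    ((Scheme.Modules.pullback (snd A.X (A.dualOf Θ hΘ).X).left).obj
      (tensorPow (linePtHat A hΘ hK (α ≫ phiThetaInv A hΘ hK)) (2 * s + 1)))

/-- `N_α` is finite locally free. [cite: StacksProject, Tag 01CA] -/
theorem isFiniteLocallyFree_descentTwistTranslate : IsFiniteLocallyFree (descentTwistTranslate A hΘ hK s j α) :=
  isFiniteLocallyFree_tensorObj _ _
    ((isFiniteLocallyFree_tensorPow (isFiniteLocallyFree_linePt A hΘ hK α) j).pullback _)
    ((isFiniteLocallyFree_tensorPow (isFiniteLocallyFree_linePtHat A hΘ hK (α ≫ phiThetaInv A hΘ hK)) (2 * s + 1)).pullback _)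

/-- `N_α` has rank one. [cite: StacksProject, Tag 01CA] -/
theorem hasRank_descentTwistTranslate : HasRank (descentTwistTranslate A hΘ hK s j α) 1 :=
  hasRank_tensorObj_one
    (hasRank_pullback _ (hasRank_tensorPow_one (hasRank_linePt A hΘ hK α) j))
    (hasRank_pullback _ (hasRank_tensorPow_one (hasRank_linePtHat A hΘ hK (α ≫ phiThetaInv A hΘ hK)) (2 * s + 1)))

variable {T : SchemeOver ℂ} [IsIntegral T.left]

/-- **The class of `N_α` along a `T`-valued point `h = (h₁, h₂)` of `A × Â`:**
`ofMul (h^*[N_α]) = j • Λ(h₁, (φ⁻¹α)_T) + (2s+1) • Λ((φ⁻¹α)_T, h₂·φ⁻¹)`. [cite: Lange2023AbelianVarietiesComplex, §6.1.1 Lemma 6.1.3]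
[cite: MumfordAV1970, §8 (the pairing Λ(L))] -/
theorem ofMul_pullback_detClass_descentTwistTranslate (h : T ⟶ A.X ⊗ (A.dualOf Θ hΘ).X) :
    Additive.ofMul (CechPic.pullback h.left (detClass (isFiniteLocallyFree_descentTwistTranslate A hΘ hK s j α))) =
      j • AbelianVariety.Lam Θ (cechCl T.left) (h ≫ fst _ _) (toSpecOver T ≫ α ≫ phiThetaInv A hΘ hK) +
        (2 * s + 1) • AbelianVariety.Lam Θ (cechCl T.left) (toSpecOver T ≫ α ≫ phiThetaInv A hΘ hK)
          (h ≫ snd _ _ ≫ phiThetaInv A hΘ hK) := by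
  have hP := isFiniteLocallyFree_linePt A hΘ hK α
  have hPr := hasRank_linePt A hΘ hK α
  have hQ := isFiniteLocallyFree_linePtHat A hΘ hK (α ≫ phiThetaInv A hΘ hK)
  have hQr := hasRank_linePtHat A hΘ hK (α ≫ phiThetaInv A hΘ hK)
  rw [detClass_tensorObj_of_hasRank_one (hasRank_pullback _ (hasRank_tensorPow_one hPr j))
      (hasRank_pullback _ (hasRank_tensorPow_one hQr (2 * s + 1)))
      ((isFiniteLocallyFree_tensorPow hP j).pullback _) ((isFiniteLocallyFree_tensorPow hQ (2 * s + 1)).pullback _)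
      (isFiniteLocallyFree_descentTwistTranslate A hΘ hK s j α),
    detClass_pullback _ (isFiniteLocallyFree_tensorPow hP j), detClass_pullback _ (isFiniteLocallyFree_tensorPow hQ (2 * s + 1)),
    detClass_tensorPow hPr hP, detClass_tensorPow hQr hQ]
  simp only [MonoidHom.map_mul, MonoidHom.map_pow, ofMul_mul, ofMul_pow]
  rw [← cechPic_pullback_comp, ← cechPic_pullback_comp, ← Over.comp_left, ← Over.comp_left, ofMul_pullback_detClass_linePt,
    ofMul_pullback_detClass_linePtHat, Category.assoc]

end Discrepancy

/-! ### §2 The class of `D′_s` along `h ≫ (1 × t_α)` -/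

section ClassIdentity

variable (s j : ℕ) (α : (A.dualOf Θ hΘ).Points ℂ) {T : SchemeOver ℂ} [IsIntegral T.left]

/-- **THE CLASS IDENTITY along `T`-valued points: `[D′_s](h ≫ (1 × t_α)) = [D′_s](h) + [N_α](h)`** for every `h = (h₁, h₂) : T → A × Â` —
i.e. `(1 × t_α)^*[D′_s](h) = [D′_s](h) + j • Λ(h₁, (φ⁻¹α)_T) + (2s+1) • Λ((φ⁻¹α)_T, h₂φ⁻¹)`: under `h ↦ h ≫ (1 × t_α)` the component
`h₁` is unchanged and `h₂φ⁻¹` becomes `(φ⁻¹α)_T · h₂φ⁻¹`; expand by the biadditivity of `Λ` (the cubical structure) and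
`λ(xy) = Λ(x,y) + λ(x) + λ(y)`, `λ(c_T) = 0`, `Λ(x⁻¹, y⁻¹) = Λ(x, y)`. [cite: Markman2025SecantWeil, §9.3 Lemma 9.3.3 p. 71 L54–70]
[cite: Lange2023AbelianVarietiesComplex, §6.1.1 Lemma 6.1.3] [cite: MumfordAV1970, §6 Cor. 3–4 and §8] -/
theorem ofMul_pullback_whiskerLeft_translation_detClass_descentTwist (h : T ⟶ A.X ⊗ (A.dualOf Θ hΘ).X) :
    Additive.ofMul (CechPic.pullback (h ≫ A.X ◁ (A.dualOf Θ hΘ).translation α).left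
        (detClass (isFiniteLocallyFree_descentTwist A hΘ hK s j))) =
      Additive.ofMul (CechPic.pullback h.left (detClass (isFiniteLocallyFree_descentTwist A hΘ hK s j))) +
        Additive.ofMul (CechPic.pullback h.left (detClass (isFiniteLocallyFree_descentTwistTranslate A hΘ hK s j α))) := by
  have hadd := cechCl_add T.left
  have heq := linEquiv_iff_cechCl_eq T.left
  have hcube := A.cubicalStructure_linEquiv_holds
  -- the substitution `h ↦ h ≫ (1 × t_α)`: `h₁` is unchanged, `h₂ φ⁻¹ ↦ (φ⁻¹α)_T · (h₂ φ⁻¹)`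
  have h₁ : (h ≫ A.X ◁ (A.dualOf Θ hΘ).translation α) ≫ fst _ _ = h ≫ fst _ _ := by
    rw [Category.assoc, whiskerLeft_fst]
  have h₂ : (h ≫ A.X ◁ (A.dualOf Θ hΘ).translation α) ≫ snd _ _ ≫ phiThetaInv A hΘ hK =
      (toSpecOver T ≫ α ≫ phiThetaInv A hΘ hK) * (h ≫ snd _ _ ≫ phiThetaInv A hΘ hK) := by
    rw [Category.assoc, whiskerLeft_snd_assoc, translation_comp_phiThetaInv, ← Category.assoc (snd _ _),
      AbelianVariety.comp_translation_eq_mul, MonObj.comp_mul, ← Category.assoc h (toSpecOver _), comp_toSpecOver]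
  -- names for the atoms
  set c := toSpecOver T ≫ α ≫ phiThetaInv A hΘ hK with hc
  set y := h ≫ snd _ _ ≫ phiThetaInv A hΘ hK with hy
  set x := h ≫ fst _ _ with hx
  have hlc : AbelianVariety.lam Θ (cechCl T.left) c = 0 := AbelianVariety.lam_toSpecOver_comp heq hadd _
  have hlc' : AbelianVariety.lam Θ (cechCl T.left) c⁻¹ = 0 := by
    rw [hc, ← GrpObj.comp_inv]
    exact AbelianVariety.lam_toSpecOver_comp heq hadd _
  have hΛinv : AbelianVariety.Lam Θ (cechCl T.left) c⁻¹ y⁻¹ = AbelianVariety.Lam Θ (cechCl T.left) c y := by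
    rw [Lam_inv_left, Lam_inv_right, neg_neg]
  rw [ofMul_pullback_detClass_descentTwist, ofMul_pullback_detClass_descentTwist, ofMul_pullback_detClass_descentTwistTranslate,
    h₁, h₂, ← hc, ← hy, ← hx, AbelianVariety.Lam_mul_right hadd heq hcube, mul_inv, lam_mul_eq, lam_mul_eq, hlc, hlc', hΛinv]
  simp only [smul_add, add_smul, one_smul, two_mul, add_zero]
  abel

end ClassIdentity

/-! ### §3 The identity in `Ȟ¹(A × Â, 𝒪^×)` and its module form -/

section ModuleForm

variable (s j : ℕ) (α : (A.dualOf Θ hΘ).Points ℂ)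

/-- **THE TRANSLATE IDENTITY IN `Ȟ¹`: `(1_A × t_α)^*[D′_s] = [D′_s] · [N_α]`** for the descent twist `D′_s` and every complex point `α`
of `Â` (the class identity at `T = A × Â`, `h = 𝟙`; `(1 × t_α)` is the scheme automorphism `sndTranslationIso Â α A`).
[cite: Markman2025SecantWeil, §9.3 Lemma 9.3.3 and Lemma 9.3.5 (p. 71)] [cite: Lange2023AbelianVarietiesComplex, §6.1.1 Lemma 6.1.3] -/
theorem pullback_sndTranslation_detClass_descentTwist :
    CechPic.pullback (sndTranslationIso (A.dualOf Θ hΘ) α A).hom (detClass (isFiniteLocallyFree_descentTwist A hΘ hK s j)) =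
      detClass (isFiniteLocallyFree_descentTwist A hΘ hK s j) *
        detClass (isFiniteLocallyFree_descentTwistTranslate A hΘ hK s j α) := by
  have h := ofMul_pullback_whiskerLeft_translation_detClass_descentTwist A hΘ hK s j α (𝟙 (A.X ⊗ (A.dualOf Θ hΘ).X))
  rw [Category.id_comp, Over.id_left, CechPic.pullback_id_apply, CechPic.pullback_id_apply, ← ofMul_mul] at h
  exact Additive.ofMul.injective h

/-- **MODULE FORM: `(1_A × t_α)^*D′_s ≅ D′_s ⊗ N_α`** with `N_α = pr_A^*P_α^{⊗j} ⊗ pr_Â^*P̂_{φ⁻¹α}^{⊗(2s+1)}` EXPLICIT (rank-one modules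
are classified by their class, `nonempty_iso_iff_detClass_eq`). Objectwise; no normalisation of the isomorphism is asserted.
[cite: Markman2025SecantWeil, §9.3 Lemma 9.3.3 and Lemma 9.3.5 (p. 71)] [cite: Hartshorne1977, III Ex. 4.5] -/
theorem nonempty_pullback_sndTranslation_descentTwist_iso :
    Nonempty ((Scheme.Modules.pullback (sndTranslationIso (A.dualOf Θ hΘ) α A).hom).obj (descentTwist A hΘ hK s j) ≅
      tensorObj (descentTwist A hΘ hK s j) (descentTwistTranslate A hΘ hK s j α)) := by
  have hD := isFiniteLocallyFree_descentTwist A hΘ hK s j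
  have hD₁ := hasRank_descentTwist A hΘ hK s j
  have hN := isFiniteLocallyFree_descentTwistTranslate A hΘ hK s j α
  have hN₁ := hasRank_descentTwistTranslate A hΘ hK s j α
  refine (nonempty_iso_iff_detClass_eq (hasRank_pullback _ hD₁) (hasRank_tensorObj_one hD₁ hN₁) (hD.pullback _)
    (isFiniteLocallyFree_tensorObj _ _ hD hN)).2 ?_
  rw [detClass_pullback _ hD, pullback_sndTranslation_detClass_descentTwist, detClass_tensorObj_of_hasRank_one hD₁ hN₁ hD hN]

/-- A CHOSEN isomorphism `(1_A × t_α)^*D′_s ≅ D′_s ⊗ N_α`. [cite: Markman2025SecantWeil, §9.3 Lemma 9.3.3 and Lemma 9.3.5 (p. 71)] -/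
def pullbackSndTranslationDescentTwistIso :
    (Scheme.Modules.pullback (sndTranslationIso (A.dualOf Θ hΘ) α A).hom).obj (descentTwist A hΘ hK s j) ≅
      tensorObj (descentTwist A hΘ hK s j) (descentTwistTranslate A hΘ hK s j α) :=
  (nonempty_pullback_sndTranslation_descentTwist_iso A hΘ hK s j α).some

end ModuleForm

end Literature.AlgebraicGeometry.AbelianVarieties

end
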